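import Mathlib
import HarnessLib
import HarnessLib.Audit
import Summits.BirchSwinnertonDyer.Statement
import Summits.BirchSwinnertonDyer.Rank1Residual.WAll.TargetAdditiveAtThreeCells
import Literature.NumberTheory.EllipticCurves.QuadraticTwist
import Literature.NumberTheory.EllipticCurves.ArtinMilneShaDecomposition
import Literature.NumberTheory.EllipticCurves.NonvanishingTwistsPrescribedRamificationAtThree
import Literature.NumberTheory.EllipticCurves.NonvanishingTwistsRealQuadraticTameAtThree
import Literature.NumberTheory.EllipticCurves.BSDQuotientOverNumberField
import HarnessLib.Audit.Status.Attr

/-!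
Route: TameQuarticSolvent

# Route TameQuarticSolvent — Make 3 a good prime - BSD_3 on the (t') rank-one rows from exact BSD_3
over a totally real tame quartic solvent field, squeezed back to Q by one-sided Euler-system upper
bounds

It suffices to show X = X1 ∧ X2 ∧ X3 on the W-ALL leaf `WAllExclAddTprimeAtThreeRankOne` (non-CM
E/ℚ, additive at 3 of tame class (t′): `ord₃ j ≥ 0`, `f₃ = 2`, `e = 4`, Kodaira III/III*; `r_an =
1`; 3 533 isogeny classes of the census, today the BARE residual 19984 `TameRankOne` of route KT).
X1 = SOLVENT PAIR LOWER BOUND (deciding crux `SolventPairLowerBound`, card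
tame-quartic-solvent-good-at-three K1 ∧ K2(a) ∧ P3 in their ℚ-visible form): E has a real,
3-ramified quadratic twist E^(d) (d > 0, v₃(d) = 1, again (t′) at 3, r_an = 0) with ord₃ Ш_an(E) +
ord₃ Ш_an(E^(d)) ≤ ord₃ #Ш(E) + ord₃ #Ш(E^(d)) — the shadow over ℚ of EXACT BSD₃ for E over a
totally real tame quartic SOLVENT field L″ = ℚ(√d)(√β) at whose unique place w ∣ 3 (e = 4) the curve
has GOOD supersingular reduction with a_w = 0, minus a Kolyvagin UPPER bound for the complementary
ℚ(√d)-isotypic component. X2 = `TprimeRankZeroUpperAtThree`, the Kato-side upper half ord₃ #Ш ≤ ord₃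
Ш_an on the (t′) rank-zero rows (consumed for E^(d); route KT's U₀ territory at p = 3). X3 =
`TprimeRankOneUpperAtThree`, the Heegner-side upper half on the (t′) rank-one rows. With the
published input GZK (support `PublishedInputGZK`) the three give the missing lower half for E by
subtraction and hence BSD₃(E).
Lean: `∀ (W : WeierstrassCurve ℚ) [W.IsElliptic] [W.IsGloballyMinimal], ¬ W.HasCM →
Literature.NumberTheory.EllipticCurves.Rank1Residual.Addv W 3 →
Summit.BirchSwinnertonDyer.Rank1Residual.Additive.SubTprime W 3 → W.analyticRank = 1 → ∃ (d : ℤ) (Wd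
: WeierstrassCurve ℚ) (_ : Wd.IsElliptic) (_ : Wd.IsGloballyMinimal), 0 < d ∧ padicValInt 3 d = 1 ∧
(∃ C : WeierstrassCurve.VariableChange ℚ, C • W.quadraticTwist (d : ℚ) = Wd) ∧ ¬ Wd.HasCM ∧
Literature.NumberTheory.EllipticCurves.Rank1Residual.Addv Wd 3 ∧
Summit.BirchSwinnertonDyer.Rank1Residual.Additive.SubTprime Wd 3 ∧ Wd.analyticRank = 0 ∧ ∃ q q' : ℚ,
Literature.NumberTheory.EllipticCurves.shaAn W = (q : ℂ) ∧
Literature.NumberTheory.EllipticCurves.shaAn Wd = (q' : ℂ) ∧ padicValRat 3 q + padicValRat 3 q' ≤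
(padicValNat 3 W.shaOrder : ℤ) + (padicValNat 3 Wd.shaOrder : ℤ)`

## Assembly
Pure bookkeeping in the tree's typed currency (the deciding theorem `closes`, certified): for E on
the leaf, `SolventPairLowerBound` gives (d, E_d, q, q′) with ord₃ q + ord₃ q′ ≤ ord₃ #Ш(E) + ord₃
#Ш(E_d); `TprimeRankZeroUpperAtThree` applied to E_d gives ord₃ #Ш(E_d) ≤ ord₃ q′ (the rational
value of Ш_an(E_d) is unique by `exact_mod_cast`); `linarith` yields `Typed.MissingLowerBoundAt E
3`; `TprimeRankOneUpperAtThree` gives `Typed.MissingUpperBoundAt E 3`;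
`Typed.missingPPartAt_of_lower_of_upper` and `Typed.bsdp_of_missingPPartAt` (with
`PublishedInputGZK` and r_an = 1 ≤ 1) give `BSDp E 3`, i.e. the leaf
`Summit.BirchSwinnertonDyer.WAllExclAddTprimeAtThreeRankOne` (R5 alternative closer of the W-ALL
cell).

CLOSES_TARGET: closes rung W-ALL/2@3.TprimeAtThreeRankOne of BirchSwinnertonDyer: Summit.BirchSwinnertonDyer.WAllExclAddTprimeAtThreeRankOne (D-0061; not the summit Statement) — the deciding theorem of this route concludes that registered leaf instead of the Statement decl `BirchSwinnertonDyer` (class rung: servable and labelled, never counted as concluding the summit Statement).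

Rationale: WHY THIS LINE. At an additive potentially supersingular 3 of class (t′) every native 3-adic engine
is dead (D_cris(V₃E|G_ℚ₃) = 0, a₃ = 0 so U₃ kills Heegner/Mazur–Tate towers, no finite-slope family
through the supercuspidal π₃, no admissible primes since 3 ∣ ℓ² − 1: cell catalogue
BARRIERS-AT3-R1-pss3g3 §1–§3 and
`Literature.Barriers.BirchSwinnertonDyer.NoAdmissiblePrimesAtThree`), and the only printed Iwasawa
theory at unstable primes (Delbourgo 1998 Hyp. (G); Kohen–Pacetti arXiv:1801.01619 "SRAE") needs E
good over an ABELIAN extension of ℚ₃, i.e. e ∣ p − 1 = 2 — exactly what (t′) (e = 4) violates. The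
lever imported from the arithmetic of base change (Milne1972ArithmeticAV: BSD is invariant under
restriction of scalars; Artin formalism of L(E/L″,s); cor∘res on prime-to-[L″:ℚ] parts) is to pass
instead to a NON-Galois totally real tame quartic L″ ⊃ k″ = ℚ(√d) with e(w∣3) = 4: there E acquires
GOOD supersingular reduction with a_w = 0 exactly (the Weil representation at 3 is induced from W_ℚ₉
and every Frobenius of L″_w lies outside W_ℚ₉), so the finite-slope machinery that is vacuous over ℚ
becomes available over L″ — signed Coleman maps along the 3-tower of L″_w (Kobayashi2003; B.D. Kim
arXiv:1608.03315 for ramified base), a two-variable anticyclotomic main conjecture over the CM field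
K·L″ with w SPLIT (CastellaWan2022, Wan2020, BertoliniDarmonPrasanna2013, CastellaHsieh2018;
Howard2004HeegnerKolyvagin / Nekovar2007 Kolyvagin systems over totally real fields), and
Friedberg–Hoffstein twists with prescribed local behaviour (FriedbergHoffstein1995) to choose d and
β with r_an(E^(d)) = r_an(E_k″ ⊗ χ_β) = 0. Since the Galois closure of L″ is D₄, the ℚ-component
cannot be isolated at the level of p-adic L-functions (cell barrier
InfiniteSlopeSurvivesBaseChange); the route isolates it only at the level of INTEGERS, by the
one-sided squeeze δ₃(E) = δ₃(E/L″) − δ₃(E^(d)) − δ₃(E′/k″) ≥ 0 in which the two auxiliary defects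
need only UPPER bounds (Kato2004 §14 for E^(d); Kolyvagin over k″(√(βd₀)) plus a twist-pair
3-indivisibility of KrizLi2019 type for E′ = E_k″ ⊗ χ_β) — so no lower bound is ever asked of an
auxiliary object, which is what killed every sandwich with auxiliary lower bounds. What no prior
route or negatives entry does: KT/K9/SOED/UTD all work over ℚ or an imaginary quadratic field at the
BAD prime 3 (Kato descent, semi-ordinary Eisenstein descent, deformation transport);
SignedBaseChange squeezes over four ℚ-twists at a prime that is already GOOD; nobody makes the
additive prime good by a solvable non-abelian base change and comes back one-sidedly.

RANKED CRUXES. #2 SolventPairLowerBound (crux) — For every non-CM, globally minimal E/ℚ additive at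
3 of class (t′) with r_an(E) = 1 there are an integer d > 0 with v₃(d) = 1 and a globally minimal
model E_d of the quadratic twist E^(d), again non-CM, additive of class (t′) at 3, with r_an(E_d) =
0, such that Ш_an(E), Ш_an(E_d) are rational numbers q, q′ with ord₃ q + ord₃ q′ ≤ ord₃ #Ш(E) + ord₃
#Ш(E_d) (card K1 ∧ K2(a) ∧ P3: exact BSD₃(E/L″) over the tame quartic solvent field, Kolyvagin upper
bound for E_k″ ⊗ χ_β, Artin–Milne bookkeeping L(E/L″,s) = L(E,s)·L(E^(d),s)·L(E_k″ ⊗ χ_β,s)).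
[difficulty: XL] (why it might fail: Exact BSD₃(E/L″) needs a signed two-variable IMC over K·L″ at p
= 3 with e(w∣3) = 4 > p − 1 (no ± Coleman maps in print for a non-abelian ramified base) and the
E′-upper bound needs a twist pair with 3 ∤ Ш_an·∏c, open in Kriz–Li generality.)
[Milne1972ArithmeticAV, FriedbergHoffstein1995, Kobayashi2003, arXiv:1608.03315, CastellaWan2022,
Wan2020, BertoliniDarmonPrasanna2013, Howard2004HeegnerKolyvagin, Nekovar2007, KrizLi2019,
YuanZhangZhang2013, CaiShuTian2014]
#3 TprimeRankOneUpperAtThree (crux) — For every non-CM, globally minimal E/ℚ additive at 3 of class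
(t′) with r_an(E) = 1: Ш_an(E) is a rational q with ord₃ #Ш(E) ≤ ord₃ q (the Euler-system UPPER half
at 3 in the tree's `Typed.MissingUpperBoundAt` currency; Kolyvagin's bound with Jetchev's
Σ-sharpening on the 731 surjective-image classes, Kato-type arguments elsewhere; the 2 705 classes
with E[3] reducible have no printed bound). [difficulty: XL] (why it might fail: On 2 705 of the 3
533 classes E[3] is reducible (rational 3-isogeny): no Kolyvagin/Heegner upper bound for Ш[3^∞] is
in print there, and at additive 3 the index [E(K):ℤy_K] carries c₃ = 2 and the Manin constant, so
even the onto rows need Jetchev's exact Σ-form at p = 3.) [Kolyvagin1990, Gross1991, Jetchev2008,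
Howard2004HeegnerKolyvagin, GrossZagier1986, CastellaGrossiLeeSkinner2022]
#4 TprimeRankZeroUpperAtThree (crux) — For every non-CM, globally minimal E/ℚ additive at 3 of class
(t′) with r_an(E) = 0: Ш_an(E) is a rational q with ord₃ #Ш(E) ≤ ord₃ q (Kato 2004 Thm 14.5(3) gives
it on the rows with ρ_(E,3^∞) surjective and 3 ∤ Tam(E); the non-surjective and reducible rows are
exactly route KT's upper-half items `TameUpperNonsurjTower` 19202, `ReducibleKatoMember`,
`TameUpperDefectRankZero` at p = 3 — this item is their p = 3 conjunction and is consumed here only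
for the auxiliary twist E^(d)). [difficulty: L] (why it might fail: Kato's divisibility at p = 3
additive has the (12.5.2) big-image hypothesis; on the reducible / non-surjective (t′) rank-zero
rows the member bound needs an Iwasawa-H¹ torsion-freeness and a μ-type input not in print (barriers
EulerSystemBigImageBarrier, EisensteinMuBarrier).) [Kato2004, SkinnerUrban2014,
CastellaGrossiLeeSkinner2022, CoatesSujatha2010]
#9 PublishedInputGZK (support) — Published input, by name: the Gross–Zagier–Kolyvagin theorem rank
E(ℚ) = r_an(E) and #Ш(E) < ∞ when r_an(E) ≤ 1 (tree named fact
`rank_eq_analyticRank_of_analyticRank_le_one`), consumed by the bridge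
`Typed.bsdp_of_missingPPartAt`. [difficulty: provable-now] [GrossZagier1986, Kolyvagin1990]

TWO-LAYER PLAN. Foreseen glued splits (none filed now): `SolventPairLowerBound ⇐ SolventTwistDatum →
SolventGoodReduction → SolventPairGivenGoodField → SolventPairLowerBound` (the birth skeleton
`Lines/birth.lean`: Friedberg–Hoffstein admissible rank-zero twist; the LEVER "(t′) at 3 ⇒ good
reduction at every place with e(w∣3) = 4" as the named first lemma; the pair inequality given such a
field); later `SolventPairGivenGoodField ⇐ ExactBSD3OverSolvent (K1) →
KolyvaginUpperTwistedComponent (K2a) → restriction-of-scalars bookkeeping (P3)` once a BSD-quotient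
currency over number fields is typed (definition request D1). `TprimeRankOneUpperAtThree ⇐ onto rows
(Kolyvagin + Jetchev Σ at 3) → reducible rows`; `TprimeRankZeroUpperAtThree ⇐ Kato (12.5.2) rows →
KT's U₀ items by name`.

KILL CRITERIA. Refuted outright (close --reason refuted:SolventPairLowerBound) if a (t′) rank-one E
is exhibited all of whose admissible twists violate the pair inequality (this contradicts BSD
itself, so the realistic kills are of the MECHANISM): (i) if E does NOT acquire good reduction over
ℚ₃(3^(1/4)) for some (t′) curve (lever certificate false ⇒ the line is dead, pivot: none); (ii) if
a_w ≠ 0 for some (t′) curve over the quartic (signed theory must be replaced by ♯/♭: pivot, not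
death); (iii) if Kim-type ± subgroups provably fail to exist along the 3-tower of ℚ₃(3^(1/4)) (K1
loses its local conditions: pivot to a ♯/♭ or Wach-module formulation, else death). A proof of KT's
residual `TameRankOne` 19984 at p = 3 elsewhere moots the route (superseded).

NOT DECOMPOSED YET. K1 (exact BSD₃ of E over L″ via the signed two-variable IMC over K·L″) and K2(a)
(Kolyvagin over k″(√(βd₀)) + twist-pair 3-indivisibility) are deliberately folded into
`SolventPairLowerBound`: their natural statements need a BSD-quotient / Ш_an currency for elliptic
curves over number fields that the tree lacks (definition request below); the regime split of
`TprimeRankOneUpperAtThree` by mod-3 image (731 onto / 97 normaliser / 2 705 reducible classes) and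
of `TprimeRankZeroUpperAtThree` into Kato rows vs KT's U₀ rows are layer-2 children for tenure.

CHEAPEST FALSIFIER. Tate's algorithm over F = ℚ₃(3^(1/4)) on the census representatives 55818h
(onto) and the smallest X3-reducible (t′) rank-one class: the conductor exponent of E/F at the prime
above 3 must be 0 (good reduction) and the reduced curve must have a_w = 0; one
`ellglobalred`/`elllocalred` call per curve over the quartic field (kit not available to this seat —
handed to the refuter / census cell as ASK). A nonzero conductor exponent kills the lever and the
route.

NUMBERS. Leaf mass 3 533 rank-one (t′) isogeny classes at N < 5·10⁵ (census BLOCK-A dossier v1: E[3]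
reducible 2 705, surjective 731, normaliser 97; Kodaira III 3 114 / III* 419; c₃ = 2 throughout); e
= 4, f₃ = 2, v₃(Δ_min) ∈ {3, 9}; [L″:ℚ] = 4 with Galois closure D₄ of order 8 (prime to 3); a_w = 0
and the Frobenius eigenvalues at w are ±√−3; Kolyvagin primes at p = 3 exist (ℓ inert in K, 3 ∣ a_ℓ,
3 ∣ ℓ + 1) while admissible (level-raising) primes do not (3 ∣ ℓ² − 1 for every ℓ > 3).

DEFINITION REQUESTS. D1 `BSDQuotientOverNumberField` (Ш_an(E/F) for a modular elliptic curve over a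
totally real field F, with the period/regulator conventions of Yuan–Zhang–Zhang and Cai–Shu–Tian)
and D2 `ArtinMilneDecomposition` (the 3-adic BSD defect of E/L″ as the sum of the defects of the
Artin constituents E, E^(d), E_k″ ⊗ χ_β) — to be filed under
Summits/BirchSwinnertonDyer/BirchSwinnertonDyer/Theorems once the route is open; until then K1/K2(a)
live inside `SolventPairLowerBound`.

Novelty: Searches (2026-08-27): `lit search --hybrid "restriction of scalars Birch Swinnerton-Dyer invariance
isogeny Milne"` (10 docs; Dokchitser–Dokchitser 2010 only relevant); `lit vsearch "p-part of BSD by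
base change to a field of good reduction then descend isotypic components"` (10 textbook hits, none
on point); `lit search "Delbourgo unstable primes Iwasawa elliptic"` (8 local: Delbourgo 1998/2002,
arXiv:1801.01619, arXiv:1808.07726); `lit search "Longo totally real Birch Swinnerton-Dyer
Kolyvagin"` (Longo 2006, Nekovář 2011, Longo 2012); `lit search "Kobayashi p-adic Gross-Zagier
supersingular"`, `"Wan supersingular elliptic curves main conjecture"`, `"Castella Wan Perrin-Riou
Heegner supersingular"` (engines held: arXiv:1411.6352, arXiv:1607.02019, arXiv:1804.10993); `lit
galaxy search "potentially good reduction|base change|p-part of BSD" --star all` and `"unstable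
primes|additive reduction Iwasawa" --star all` (Delbourgo, Kohen–Pacetti, B.D. Kim only); `lit
frontier BirchSwinnertonDyer --since 2020`, `lit bridges BirchSwinnertonDyer --cross any` (no
base-change-to-good-reduction BSD_p paper); `lean search 'HasGoodReductionAt'`, `'quadraticTwist'`,
`'shaOrder'` (tree currency exists over ℚ only).
Nearest prior art found: [corpus:delbourgo1998 p.8] Hyp. (G) and [corpus:arxiv-1801.01619 p.3]
(Iwasawa theory at unstable p only after ABELIAN semistabilisation inside ℚ_p(μ_p), e ∣ p − 1);
[corpus:arxiv-1608.03315 p.3] (± local conditions over a ramified base with good reduction  [refs: 10.5802/aif.2197, 1801.01619, 1808.07726, 1411.6352, 1607.02019, 1804.10993, arxiv-1801.01619, arxiv-1608.03315, doi:10.5802/aif.2197]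

Barriers (technique_class: solvent-base-change, signed-iwasawa, one-sided-squeeze): - technique_class: solvent-base-change, signed-iwasawa, one-sided-squeeze
- Literature.Barriers.BirchSwinnertonDyer.NoAdmissiblePrimesAtThree: conceded for its whole class
and designed around — no level raising anywhere; the lower bound inside `SolventPairLowerBound` is
an IMC/Eisenstein-side divisibility over K·L″ and every upper bound (Howard–Nekovář Kolyvagin system
over L″, the E′-bound, `TprimeRankOneUpperAtThree`) runs on Kolyvagin primes (which exist at p = 3)
or on Kato's classes.
- Literature.Barriers.BirchSwinnertonDyer.PAdicHeightBarrier: the rank-one conversion over K·L″ is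
meant to go through the BDP value L_𝔴^BDP(1) = unit·log_w(y)² at the split good prime w (log_w
injective on non-torsion points), not through a 3-adic regulator; if a Kobayashi-type 3-adic
Gross–Zagier formula is used instead the barrier bites and must be declared residual.
- Literature.Barriers.BirchSwinnertonDyer.EulerSystemBigImageBarrier: bites
`TprimeRankZeroUpperAtThree` and `TprimeRankOneUpperAtThree` on the small-image rows exactly as in
KT (2 705 reducible rank-one classes; the reducible rank-zero twists): conceded — those rows are the
honest residual mass of the two upper-half cruxes, untouched by the lever, and are why both are
ranked cruxes and not supports.
- Literature.Barriers.BirchSwinnertonDyer.ReducibleAnticyclotomicAtBadP: outside the technique class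
— the anticyclotomic objects of the deciding crux live over K·L″ at a GOOD split prime w (scope (A)
`Good` holds literally after

sub-problem: BirchSwinnertonDyer · status: open · opened planner-bsd-wall-pss3-g6-0 2026-08-27T18:48:34Z · rev 7 · ledger route-BirchSwinnertonDyer-TameQuarticSolvent
GENERATED by the gate from the ledger (D-0016/17). Provers cite these decls: `theorem foo : Summit.BirchSwinnertonDyer.BirchSwinnertonDyer.Theses.TameQuarticSolvent.<Decl> := …` in Summits/BirchSwinnertonDyer/BirchSwinnertonDyer/Theorems/<Name>.lean.
-/

namespace Summit.BirchSwinnertonDyer.BirchSwinnertonDyer.Theses.TameQuarticSolvent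

open scoped BigOperators Topology Manifold Classical MeasureTheory ProbabilityTheory Matrix InnerProductSpace ComplexConjugate ContinuousMap
open Filter Set Function TopologicalSpace MeasureTheory

attribute [summit_statement] _root_.BirchSwinnertonDyer
attribute [summit_statement] _root_.Summit.BirchSwinnertonDyer.WAllExclAddTprimeAtThreeRankOne

open Literature

/-- item stmt-BirchSwinnertonDyer-21391 · crux · rank 2 · SPLIT (gen 1) into SolventPublishedInputs, LowerBSD3OverSolventQuartic, KolyvaginUpperRankZeroOverK, KolyvaginTwistedUpperOverKNoOddMult + glue SolventPairLowerBoundGlue · direct attempts still welcome (low priority) · by planner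
why it might fail: Exact BSD₃(E/L″) needs a signed two-variable IMC over K·L″ at p = 3 with e(w∣3) = 4 > p − 1 (no ± Coleman maps in print for a non-abelian ramified base) and the E′-upper bound needs a twist pair with 3 ∤ Ш_an·∏c, open in Kriz–Li generality.
sources: Milne1972ArithmeticAV, FriedbergHoffstein1995, Kobayashi2003, arXiv:1608.03315, CastellaWan2022, Wan2020
[crux] For every non-CM, globally minimal E/ℚ additive at 3 of class (t′) with r_an(E) = 1 there are
an integer d > 0 with v₃(d) = 1 and a globally minimal model E_d of the quadratic twist E^(d), again
non-CM, additive of class (t′) at 3, with r_an(E_d) = 0, such that Ш_an(E), Ш_an(E_d) are rational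
numbers q, q′ with ord₃ q + ord₃ q′ ≤ ord₃ #Ш(E) + ord₃ #Ш(E_d) (card K1 ∧ K2(a) ∧ P3: exact
BSD₃(E/L″) over the tame quartic solvent field, Kolyvagin upper bound for E_k″ ⊗ χ_β, Artin–Milne
bookkeeping L(E/L″,s) = L(E,s)·L(E^(d),s)·L(E_k″ ⊗ χ_β,s)). [difficulty: XL] -/
@[route_item "route-BirchSwinnertonDyer-TameQuarticSolvent", crux]
def SolventPairLowerBound : Prop :=
  ∀ (W : WeierstrassCurve ℚ) [W.IsElliptic] [W.IsGloballyMinimal], ¬ W.HasCM → Literature.NumberTheory.EllipticCurves.Rank1Residual.Addv W 3 → Summit.BirchSwinnertonDyer.Rank1Residual.Additive.SubTprime W 3 → W.analyticRank = 1 → ∃ (d : ℤ) (Wd : WeierstrassCurve ℚ) (_ : Wd.IsElliptic) (_ : Wd.IsGloballyMinimal), 0 < d ∧ padicValInt 3 d = 1 ∧ (∃ C : WeierstrassCurve.VariableChange ℚ, C • W.quadraticTwist (d : ℚ) = Wd) ∧ ¬ Wd.HasCM ∧ Literature.NumberTheory.EllipticCurves.Rank1Residual.Addv Wd 3 ∧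 Summit.BirchSwinnertonDyer.Rank1Residual.Additive.SubTprime Wd 3 ∧ Wd.analyticRank = 0 ∧ ∃ q q' : ℚ, Literature.NumberTheory.EllipticCurves.shaAn W = (q : ℂ) ∧ Literature.NumberTheory.EllipticCurves.shaAn Wd = (q' : ℂ) ∧ padicValRat 3 q + padicValRat 3 q' ≤ (padicValNat 3 W.shaOrder : ℤ) + (padicValNat 3 Wd.shaOrder : ℤ)

-- parent: SolventPairLowerBound · child (gen 1)
/--     item stmt-BirchSwinnertonDyer-23963 · crux · rank 202 · open
    parent: SolventPairLowerBound · by planner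
    why it might fail: No ±/♯♭ Selmer conditions or Coleman maps in print at e(w|3) = 4 > p − 1 (nearest: base-change ±, p ≥ 5, arXiv:2407.08430); Kobayashi's congruence [3](t) ≡ h(t⁹) mod 3 holds on (t′) sub-row B (with E(M_w)[3] = 0: p603629) but FAILS on sub-row A (p596607/p596942): no signed condition there.
    sources: Kobayashi2003, Wan2020, CastellaWan2022, arXiv:2407.08430, arXiv:1608.03315, Milne1972ArithmeticAV
[crux K1⁻ — the real crux of line birth, promote-stub by three leads] for E/ℚ on the (t′) rank-one
leaf and every totally real quartic M ⊃ K ([K:ℚ] = [M:K] = 2) with ramification index 4 above 3 and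
good reduction of E_M at every place above 3: IF Ш(E_M/M)[3^∞] is finite THEN every rational value
qM of #Ш_an(E_M/M) satisfies ord₃ qM ≤ ord₃ #Ш(E_M/M)[3^∞] — the LOWER half of BSD₃ for E over M
only (main-conjecture «⊇» / Eisenstein direction of signed Iwasawa theory over the ramified quartic
base, e = 4 > p − 1, at the good supersingular w with a_w = 0); implied by BSD for E/M. = registered
v6 stub `stub_lowerBSD3OverSolventQuartic` verbatim. [deps: SolventPublishedInputs] [difficulty: XL] -/
@[route_item "route-BirchSwinnertonDyer-TameQuarticSolvent", crux]
def LowerBSD3OverSolventQuartic : Prop :=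
  ∀ (W : WeierstrassCurve ℚ) [W.IsElliptic] [W.IsGloballyMinimal], ¬ W.HasCM → Literature.NumberTheory.EllipticCurves.Rank1Residual.Addv W 3 → Summit.BirchSwinnertonDyer.Rank1Residual.Additive.SubTprime W 3 → W.analyticRank = 1 → ∀ (K : Type) [Field K] [NumberField K] (M : Type) [Field M] [NumberField M] [Algebra K M], Module.finrank ℚ K = 2 → Module.finrank K M = 2 → NumberField.IsTotallyReal M → (∀ w : IsDedekindDomain.HeightOneSpectrum (NumberField.RingOfIntegers M), ((3 : ℕ) : NumberField.RingOfIntegers M) ∈ w.asIdeal → w.asIdeal.ramificationIdx ℤ = 4) → (∀ w : IsDedekindDomain.HeightOneSpectrum (NumberField.RingOfIntegers M), ((3 : ℕ) : NumberField.RingOfIntegers M) ∈ w.asIdeal → (W.baseChange M).HasGoodReductionAt w) → Finite (AddCommGroup.primaryComponent (W.baseChange M).sha 3) → ∀ qM : ℚ, Literature.NumberTheory.EllipticCurves.analyticSha (W.baseChange M) = (qM : ℂ) → padicValRat 3 qM ≤ padicValNat 3 (Nat.card (AddCommGroup.primaryComponent (W.baseChange M).sha 3))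

-- parent: SolventPairLowerBound · child (gen 1)
/--     item stmt-BirchSwinnertonDyer-23964 · crux · rank 203 · open
    parent: SolventPairLowerBound · by planner
    why it might fail: The SHARP 3-part is not in print: Kolyvagin–Logachëv/Longo/Nekovář give index² bounds with Tamagawa/Manin slack and need big image (E′[3] may be reducible); no Kato Euler system for non-base-change Hilbert newforms; #Ш_an(E′/K) ∈ ℚ itself is unprinted.
    sources: Nekovar2007, LongoVigni2010, Zhang2001, YuanZhangZhang2013, Kolyvagin1990, Howard2004HeegnerKolyvagin
[crux K2a-ES₀ — Euler-system half of K2a in analytic rank ZERO] for W on the leaf having an ODD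
prime ℓ₀ ≠ 3 of multiplicative reduction (3 462 / 3 533 census classes), every d > 0 with ord₃ d =
1, every quadratic K ∋ θ₁ (θ₁² = d), every β ∈ K of odd valuation above 3 and totally positive such
that E′ = (W_K)^{(β)} (GOOD supersingular at 𝔭 ∣ 3, a_𝔭 = 0: p584727/p586232) has an entire
L-function with L(E′/K,1) ≠ 0: Ш(E′/K)[3^∞] is finite, #Ш_an(E′/K) ∈ ℚ, and ord₃ #Ш(E′/K)[3^∞] ≤
ord₃ #Ш_an(E′/K) (Kolyvagin–Logachëv / Longo / Nekovář Euler system of CM points on the Shimura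
curve attached to E′/K, Jacquet–Langlands hypothesis met at the multiplicative place over ℓ₀; Zhang
/ Yuan–Zhang–Zhang Gross–Zagier). = registered v6 stub `stub_kolyvaginUpperRankZeroOverK` verbatim.
[deps: SolventPublishedInputs] [difficulty: XL] -/
@[route_item "route-BirchSwinnertonDyer-TameQuarticSolvent", crux]
def KolyvaginUpperRankZeroOverK : Prop :=
  ∀ (W : WeierstrassCurve ℚ) [W.IsElliptic] [W.IsGloballyMinimal], ¬ W.HasCM → Literature.NumberTheory.EllipticCurves.Rank1Residual.Addv W 3 → Summit.BirchSwinnertonDyer.Rank1Residual.Additive.SubTprime W 3 → W.analyticRank = 1 → (∃ (ℓ₀ : ℕ) (_ : Fact ℓ₀.Prime), ℓ₀ ≠ 2 ∧ ℓ₀ ≠ 3 ∧ W.HasMultiplicativeReductionAtPrime ℓ₀) → ∀ (d : ℤ), 0 < d → padicValInt 3 d = 1 → ∀ (K : Type) [Field K] [NumberField K] (θ₁ : K), Module.finrank ℚ K = 2 → θ₁ ^ 2 = (d : K) → ∀ β : K, (∀ v : IsDedekindDomain.HeightOneSpectrum (NumberField.RingOfIntegers K), ((3 : ℕ) : NumberField.RingOfIntegers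 K) ∈ v.asIdeal → ∃ k : ℤ, v.valuation K β = WithZero.exp (2 * k + 1)) → (∀ σ : K →+* ℝ, 0 < σ β) → ((W.baseChange K).quadraticTwist β).HasEntireLFunction → ((W.baseChange K).quadraticTwist β).entireLFunction 1 ≠ 0 → Finite (AddCommGroup.primaryComponent ((W.baseChange K).quadraticTwist β).sha 3) ∧ ∃ qβ : ℚ, Literature.NumberTheory.EllipticCurves.analyticSha ((W.baseChange K).quadraticTwist β) = (qβ : ℂ) ∧ (padicValNat 3 (Nat.card (AddCommGroup.primaryComponent ((W.baseChange K).quadraticTwist β).sha 3)) : ℤ) ≤ padicValRat 3 qβ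

-- parent: SolventPairLowerBound · child (gen 1)
/--     item stmt-BirchSwinnertonDyer-23965 · crux · rank 204 · open
    parent: SolventPairLowerBound · by planner
    why it might fail: On the 19 all-additive classes no local sign can be flipped by an admissible β, forcing the rank-one road over K where [E′(K):ℤy] carries Tamagawa/Manin slack at 3; and the analytic nonvanishing input over K with prescribed local behaviour at 2 is not a named fact yet.
    sources: FriedbergHoffstein1995, Zhang2001, YuanZhangZhang2013, Nekovar2007, GrossZagier1986, Kolyvagin1990
[crux K2a-rest — K2a on the ≤ 71 classes WITHOUT an odd multiplicative prime ℓ₀ ≠ 3 (19 with all bad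
primes additive, the rest with 2 the only multiplicative prime)] the v5 K2a text verbatim under ¬∃
odd multiplicative ℓ₀: for every d > 0 with ord₃ d = 1 and every quadratic K ∋ θ₁ (θ₁² = d) there is
a totally positive β ∈ K of odd valuation above 3 and a K-model Vβ ≅ (W_K)^{(β)} with entire
L-function, Ш(Vβ/K)[3^∞] finite, #Ш_an(Vβ/K) = qβ ∈ ℚ and ord₃ #Ш(Vβ/K)[3^∞] ≤ ord₃ qβ
(rank-agnostic: the rank-zero road needs a sign flip at a place over 2 or at an additive ℓ — census
ask PARITY-K2A-w2 §4 — else the rank-ONE road over K via Gross–Zagier–Zhang + Kolyvagin). =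
registered v6 stub `stub_kolyvaginTwistedUpperOverK_noOddMult` verbatim. [deps:
SolventPublishedInputs] [difficulty: L–XL] -/
@[route_item "route-BirchSwinnertonDyer-TameQuarticSolvent"]
def KolyvaginTwistedUpperOverKNoOddMult : Prop :=
  ∀ (W : WeierstrassCurve ℚ) [W.IsElliptic] [W.IsGloballyMinimal], ¬ W.HasCM → Literature.NumberTheory.EllipticCurves.Rank1Residual.Addv W 3 → Summit.BirchSwinnertonDyer.Rank1Residual.Additive.SubTprime W 3 → W.analyticRank = 1 → ¬ (∃ (ℓ₀ : ℕ) (_ : Fact ℓ₀.Prime), ℓ₀ ≠ 2 ∧ ℓ₀ ≠ 3 ∧ W.HasMultiplicativeReductionAtPrime ℓ₀) → ∀ (d : ℤ), 0 < d → padicValInt 3 d = 1 → ∀ (K : Type) [Field K] [NumberField K] (θ₁ : K), Module.finrank ℚ K = 2 → θ₁ ^ 2 = (d : K) → ∃ β : K, (∀ v : IsDedekindDomain.HeightOneSpectrum (NumberField.RingOfIntegers K), ((3 : ℕ) : NumberField.RingOfIntegers K) ∈ v.asIdeal → ∃ k : ℤ, v.valuation K β = WithZero.exp (2 * k + 1))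 ∧ (∀ σ : K →+* ℝ, 0 < σ β) ∧ ∃ (Vβ : WeierstrassCurve K) (_ : Vβ.IsElliptic), (∃ C : WeierstrassCurve.VariableChange K, C • (W.baseChange K).quadraticTwist β = Vβ) ∧ Vβ.HasEntireLFunction ∧ Finite (AddCommGroup.primaryComponent Vβ.sha 3) ∧ ∃ qβ : ℚ, Literature.NumberTheory.EllipticCurves.analyticSha Vβ = (qβ : ℂ) ∧ (padicValNat 3 (Nat.card (AddCommGroup.primaryComponent Vβ.sha 3)) : ℤ) ≤ padicValRat 3 qβ

-- parent: SolventPairLowerBound · child (gen 1)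
/--     item stmt-BirchSwinnertonDyer-23962 · support · rank 201 · open
    parent: SolventPairLowerBound · by planner
    sources: BreuilConradDiamondTaylor2001, GrossZagier1986, Kolyvagin1990, Milne1972ArithmeticAV, FriedbergHoffstein1995
[support, PUB⁸ — published inputs BY NAME, NOT a prover target; closes only via Literature `…_holds`
discharges] modularity in the two shapes the tree uses (Breuil–Conrad–Diamond–Taylor:
`exists_isNewformOf`, `nonempty_modularParametrizationData`), Gross–Zagier 1986 Thm I.(7.3),
Gross–Zagier–Kolyvagin (rank = r_an for r_an ≤ 1), Milne 1972 restriction of scalars for a relative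
quadratic extension (any model), Friedberg–Hoffstein 1995 Thm B(1) over ℚ with ramification
prescribed at 3, and Friedberg–Hoffstein Thm B(1) over the real quadratic K in the «flip» /
«no-flip» classes (p583309/p583482). = registered v6 stub `stub_publishedInputs` of line birth on
21391 verbatim. [deps: none] [difficulty: S] -/
@[route_item "route-BirchSwinnertonDyer-TameQuarticSolvent", crux]
def SolventPublishedInputs : Prop :=
  Literature.NumberTheory.EllipticCurves.ModularForms.exists_isNewformOf ∧ Literature.NumberTheory.EllipticCurves.ModularForms.nonempty_modularParametrizationData ∧ Literature.NumberTheory.EllipticCurves.GrossZagier1986_thm_I_7_3 ∧ Literature.NumberTheory.EllipticCurves.rank_eq_analyticRank_of_analyticRank_le_one ∧ Literature.NumberTheory.EllipticCurves.Milne1972.bsdQuotientP_baseChange_relQuadratic_anyModel ∧ Literature.NumberTheory.EllipticCurves.friedbergHoffstein_exists_pos_twist_ne_zero_ramifiedAtThree ∧ Literature.NumberTheory.EllipticCurves.friedbergHoffstein_exists_twist_ne_zero_realQuadratic_tameAtThree ∧ Literature.NumberTheory.EllipticCurves.friedbergHoffstein_exists_twist_ne_zero_realQuadratic_tameAtTh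ree_noflip

-- parent: SolventPairLowerBound · glue (gen 1)
/--     item stmt-BirchSwinnertonDyer-23966 · support · rank 205 · closed · proved by Summit.BirchSwinnertonDyer.BirchSwinnertonDyer.Theorems.SolventPairLowerBound.solventPairLowerBoundGlue_proof (prover)
    parent: SolventPairLowerBound · GLUE: children ⟹ parent · by planner
generated glue SolventPublishedInputs → LowerBSD3OverSolventQuartic → KolyvaginUpperRankZeroOverK →
KolyvaginTwistedUpperOverKNoOddMult → SolventPairLowerBound; closes in ONE line by `exact
Summit.BirchSwinnertonDyer.BirchSwinnertonDyer.Theorems.SolventPairLowerBound.solventPairLowerBound_of_published_of_K1low_of_K2aES0_of_K2aRest`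
(p586547, Theorems/TameQuarticSolventSolventPairLowerBoundOfV6.lean); certified in
pub/bsd-wall/bsd-wall-pss3x/SketchTQSVerify.lean b49fd1188cc3597e -/
@[route_item "route-BirchSwinnertonDyer-TameQuarticSolvent"]
def SolventPairLowerBoundGlue : Prop :=
  SolventPublishedInputs → LowerBSD3OverSolventQuartic → KolyvaginUpperRankZeroOverK → KolyvaginTwistedUpperOverKNoOddMult → SolventPairLowerBound

-- `SolventPairLowerBoundGlue` holds: proved by `Summit.BirchSwinnertonDyer.BirchSwinnertonDyer.Theorems.SolventPairLowerBound.solventPairLowerBoundGlue_proof` (its module imports this route file, so no `_holds` link can be stated here).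

/-- item stmt-BirchSwinnertonDyer-21392 · crux · rank 3 · SPLIT (gen 1) into TprimeIrreducibleManinUnit, TprimeReducibleManinUnit, TprimeHeegnerUpperOfManinUnit + glue TprimeRankOneUpperAtThreeOfManinParity · direct attempts still welcome (low priority) · by planner
why it might fail: On 2 705 of the 3 533 classes E[3] is reducible (rational 3-isogeny): no Kolyvagin/Heegner upper bound for Ш[3^∞] is in print there, and at additive 3 the index [E(K):ℤy_K] carries c₃ = 2 and the Manin constant, so even the onto rows need Jetchev's exact Σ-form at p = 3.
sources: Kolyvagin1990, Gross1991, Jetchev2008, Howard2004HeegnerKolyvagin, GrossZagier1986, CastellaGrossiLeeSkinner2022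
[crux] For every non-CM, globally minimal E/ℚ additive at 3 of class (t′) with r_an(E) = 1: Ш_an(E)
is a rational q with ord₃ #Ш(E) ≤ ord₃ q (the Euler-system UPPER half at 3 in the tree's
`Typed.MissingUpperBoundAt` currency; Kolyvagin's bound with Jetchev's Σ-sharpening on the 731
surjective-image classes, Kato-type arguments elsewhere; the 2 705 classes with E[3] reducible have
no printed bound). [difficulty: XL] -/
@[route_item "route-BirchSwinnertonDyer-TameQuarticSolvent", crux]
def TprimeRankOneUpperAtThree : Prop :=
  ∀ (W : WeierstrassCurve ℚ) [W.IsElliptic] [W.IsGloballyMinimal], ¬ W.HasCM → Literature.NumberTheory.EllipticCurves.Rank1Residual.Addv W 3 → Summit.BirchSwinnertonDyer.Rank1Residual.Additive.SubTprime W 3 → W.analyticRank = 1 → Literature.NumberTheory.EllipticCurves.Rank1Residual.Typed.MissingUpperBoundAt W 3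

-- parent: TprimeRankOneUpperAtThree · child (gen 1)
/--     item stmt-BirchSwinnertonDyer-23736 · crux · rank 301 · closed · proved by Summit.BirchSwinnertonDyer.BirchSwinnertonDyer.Theorems.TameQuarticManinParityCdtThm1.TameQuarticSolvent_TprimeIrreducibleManinUnit_proof (prover)
    parent: TprimeRankOneUpperAtThree · by planner
    why it might fail: e(U) = 4 = 2(p−1) permits a model map Ẽ_U[3] → 𝒥⁰_U[3] vanishing mod π (one full Raynaud jump), so k_min = 2 is not excluded by local group-scheme theory alone; X₀(9M) may need a wild extension to stabilise at the j = 0 = 1728 elliptic points.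
    sources: EdixhovenManin1991, doi:10.5802/aif.1202, CornellSilvermanStevens1997, KatzMazur1985, CesnaviciusNeururerSaha2023
[crux] For every non-CM globally minimal E/ℚ, additive at 3 of class (t′) (f₃ = 2, e = 4), with E[3]
irreducible, and every X₀(N)-optimal parametrisation datum D at level N = conductor (lattice clause
Λ_E = c·Λ_f and minimal degree among data with the same newform): 3 ∤ c. Mechanism: stable-fibre
parity (k_D even) + the uniserial/torus lemma (G ⊇ Ẽ[F^{k_min}]) reduce it to excluding the
prolongation branch «φ* kills Ẽ_u[3]»; on these rows Edixhoven's §4 degree chain (twist by χ₋₃ swaps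
III ↔ III*, 3 ∤ deg α since no rational 3-isogeny) is a second handle. [difficulty: L] -/
@[route_item "route-BirchSwinnertonDyer-TameQuarticSolvent", crux]
def TprimeIrreducibleManinUnit : Prop :=
  ∀ (W : WeierstrassCurve ℚ) [W.IsElliptic] [W.IsGloballyMinimal] [NeZero (W.conductorNorm ℤ)], ¬ W.HasCM → Literature.NumberTheory.EllipticCurves.Rank1Residual.Addv W 3 → Summit.BirchSwinnertonDyer.Rank1Residual.Additive.SubTprime W 3 → W.HasIrreducibleModPGaloisRep 3 → ∀ (D : Literature.NumberTheory.EllipticCurves.ModularForms.ModularParametrizationData W (W.conductorNorm ℤ)), (∀ z ∈ D.L.lattice, ∃ w ∈ Literature.NumberTheory.EllipticCurves.ModularForms.periodLattice D.f, z = D.c * w) → (∀ (W' : WeierstrassCurve ℚ) [W'.IsElliptic] (D' : Literature.NumberTheory.EllipticCurves.ModularForms.ModularParametrizationData W' (W.conductorNorm ℤ)), D'.f = D.f → D.modularDegree ≤ D'.modularDegree) → ¬ (3 : ℤ) ∣ D.maninConstant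

-- `TprimeIrreducibleManinUnit` holds: proved by `Summit.BirchSwinnertonDyer.BirchSwinnertonDyer.Theorems.TameQuarticManinParityCdtThm1.TameQuarticSolvent_TprimeIrreducibleManinUnit_proof` (its module imports this route file, so no `_holds` link can be stated here).

-- parent: TprimeRankOneUpperAtThree · child (gen 1)
/--     item stmt-BirchSwinnertonDyer-23737 · crux · rank 302 · closed · proved by Summit.BirchSwinnertonDyer.BirchSwinnertonDyer.Theorems.TameQuarticManinParityCdtThm1.TprimeReducibleManinUnit_proof (prover)
    parent: TprimeRankOneUpperAtThree · by planner
    why it might fail: With a rational 3-isogeny the kernel's closure is a rank-1 finite flat subgroup of Ẽ_U[3] that can die mod π alone, degrading the dichotomy to «3 ∤ c or the optimal curve is the étale end of the isogeny» — an isogeny-edge law the cell has only at p ≥ 5.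
    sources: EdixhovenManin1991, CesnaviciusNeururerSaha2023, AgasheRibetStein2006, CornellSilvermanStevens1997
[crux] The same conclusion 3 ∤ c on the (t′) rows whose E[3] is REDUCIBLE (a rational 3-isogeny; 2
705 of the 3 533 rank-one (t′) classes of the census). The parity/prolongation dichotomy of crux 2
does not use irreducibility; what is lost is only Edixhoven's §4 degree chain (3 ∣ deg α is
possible), so this item isolates the rows where the finite-flat-model argument must stand alone —
and where the optimal curve may sit at either end of the 3-isogeny (the flip phenomenon of
121c1/121a1 at p = 11). [difficulty: L] -/
@[route_item "route-BirchSwinnertonDyer-TameQuarticSolvent", crux]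
def TprimeReducibleManinUnit : Prop :=
  ∀ (W : WeierstrassCurve ℚ) [W.IsElliptic] [W.IsGloballyMinimal] [NeZero (W.conductorNorm ℤ)], ¬ W.HasCM → Literature.NumberTheory.EllipticCurves.Rank1Residual.Addv W 3 → Summit.BirchSwinnertonDyer.Rank1Residual.Additive.SubTprime W 3 → ¬ W.HasIrreducibleModPGaloisRep 3 → ∀ (D : Literature.NumberTheory.EllipticCurves.ModularForms.ModularParametrizationData W (W.conductorNorm ℤ)), (∀ z ∈ D.L.lattice, ∃ w ∈ Literature.NumberTheory.EllipticCurves.ModularForms.periodLattice D.f, z = D.c * w) → (∀ (W' : WeierstrassCurve ℚ) [W'.IsElliptic] (D' : Literature.NumberTheory.EllipticCurves.ModularForms.ModularParametrizationData W' (W.conductorNorm ℤ)), D'.f = D.f → D.modularDegree ≤ D'.modularDegree) → ¬ (3 : ℤ) ∣ D.maninConstant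

-- `TprimeReducibleManinUnit` holds: proved by `Summit.BirchSwinnertonDyer.BirchSwinnertonDyer.Theorems.TameQuarticManinParityCdtThm1.TprimeReducibleManinUnit_proof` (its module imports this route file, so no `_holds` link can be stated here).

-- parent: TprimeRankOneUpperAtThree · child (gen 1)
/--     item stmt-BirchSwinnertonDyer-23738 · crux · rank 303 · open
    parent: TprimeRankOneUpperAtThree · by planner
    why it might fail: Kolyvagin's bound at p = 3 needs a three-class Chebotarev substitute (Sakamoto 2024) and an image hypothesis; on the 2 705 reducible rows no Heegner-point upper bound for Ш[3^∞] is in print even with the Manin unit granted, and E(ℚ₃)[3] ≠ 0 rows shift the local index at 3.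
    sources: Kolyvagin1990, GrossZagier1986, Jetchev2008, arXiv:2505.09121, Howard2004HeegnerKolyvagin
[crux] GIVEN cruxes 2 and 3 (3 ∤ c on every non-CM (t′) optimal datum), for every non-CM globally
minimal E/ℚ additive at 3 of class (t′) with r_an = 1: Ш_an(E) is a rational q with ord₃ #Ш(E) ≤
ord₃ q — the Gross–Zagier–Kolyvagin upper half at p = 3 in the tree's `Typed.MissingUpperBoundAt`
currency, with the Manin factor of the Heegner index [E(K) : ℤy_K]² = c²·∏c_ℓ²·#Ш·(…) now a 3-unit,
c₃ = |Φ₃| = 2, and Jetchev's Σ-form for the Tamagawa factors away from 3. Strictly weaker than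
TameQuarticSolvent's item 21392 (which must also produce the Manin unit). [deps:
TprimeIrreducibleManinUnit, TprimeReducibleManinUnit] [difficulty: XL] -/
@[route_item "route-BirchSwinnertonDyer-TameQuarticSolvent", crux]
def TprimeHeegnerUpperOfManinUnit : Prop :=
  TprimeIrreducibleManinUnit → TprimeReducibleManinUnit → ∀ (W : WeierstrassCurve ℚ) [W.IsElliptic] [W.IsGloballyMinimal], ¬ W.HasCM → Literature.NumberTheory.EllipticCurves.Rank1Residual.Addv W 3 → Summit.BirchSwinnertonDyer.Rank1Residual.Additive.SubTprime W 3 → W.analyticRank = 1 → Literature.NumberTheory.EllipticCurves.Rank1Residual.Typed.MissingUpperBoundAt W 3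

-- parent: TprimeRankOneUpperAtThree · glue (gen 1)
/--     item stmt-BirchSwinnertonDyer-24526 · support · rank 304 · closed · proved by Summit.BirchSwinnertonDyer.BirchSwinnertonDyer.Theorems.tprimeRankOneUpperAtThreeOfManinParity_proof (prover)
    parent: TprimeRankOneUpperAtThree · GLUE: children ⟹ parent · by planner
modus ponens: child 3 TprimeHeegnerUpperOfManinUnit is literally TprimeIrreducibleManinUnit →
TprimeReducibleManinUnit → (21392's text verbatim, = TQMP 23738), so the glue C₁ → C₂ → C₃ →
TprimeRankOneUpperAtThree is fun h₁ h₂ h₃ ↦ h₃ h₁ h₂ (scratch tqsE/SketchE.lean rc 0) -/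
@[route_item "route-BirchSwinnertonDyer-TameQuarticSolvent"]
def TprimeRankOneUpperAtThreeOfManinParity : Prop :=
  TprimeIrreducibleManinUnit → TprimeReducibleManinUnit → TprimeHeegnerUpperOfManinUnit → TprimeRankOneUpperAtThree

-- `TprimeRankOneUpperAtThreeOfManinParity` holds: proved by `Summit.BirchSwinnertonDyer.BirchSwinnertonDyer.Theorems.tprimeRankOneUpperAtThreeOfManinParity_proof` (its module imports this route file, so no `_holds` link can be stated here).

/-- item stmt-BirchSwinnertonDyer-21393 · crux · rank 4 · open · by planner
why it might fail: Kato's divisibility at p = 3 additive has the (12.5.2) big-image hypothesis; on the reducible / non-surjective (t′) rank-zero rows the member bound needs an Iwasawa-H¹ torsion-freeness and a μ-type input not in print (barriers EulerSystemBigImageBarrier, EisensteinMuBarrier).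
sources: Kato2004, SkinnerUrban2014, CastellaGrossiLeeSkinner2022, CoatesSujatha2010
[crux] For every non-CM, globally minimal E/ℚ additive at 3 of class (t′) with r_an(E) = 0: Ш_an(E)
is a rational q with ord₃ #Ш(E) ≤ ord₃ q (Kato 2004 Thm 14.5(3) gives it on the rows with ρ_(E,3^∞)
surjective and 3 ∤ Tam(E); the non-surjective and reducible rows are exactly route KT's upper-half
items `TameUpperNonsurjTower` 19202, `ReducibleKatoMember`, `TameUpperDefectRankZero` at p = 3 —
this item is their p = 3 conjunction and is consumed here only for the auxiliary twist E^(d)).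
[difficulty: L] -/
@[route_item "route-BirchSwinnertonDyer-TameQuarticSolvent", crux]
def TprimeRankZeroUpperAtThree : Prop :=
  ∀ (W : WeierstrassCurve ℚ) [W.IsElliptic] [W.IsGloballyMinimal], ¬ W.HasCM → Literature.NumberTheory.EllipticCurves.Rank1Residual.Addv W 3 → Summit.BirchSwinnertonDyer.Rank1Residual.Additive.SubTprime W 3 → W.analyticRank = 0 → Literature.NumberTheory.EllipticCurves.Rank1Residual.Typed.MissingUpperBoundAt W 3

/-- item stmt-BirchSwinnertonDyer-19266 · aside · rank 9 · open · by planner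
sources: BreuilConradDiamondTaylor2001
[support] modularity of E/ℚ as parametrisation data (Breuil–Conrad–Diamond–Taylor 2001 Thm A), BY
NAME — conjunct of OrdPublishedInputsAtTwo (19149; Literature.Uncategorized.OrdPublishedInputsAtTwo
l.26); same content, filed so the head constant is item-stated (#15c one rule; cite_only dep) -/
@[route_item "route-BirchSwinnertonDyer-TameQuarticSolvent"]
def ModularParametrizationSupply : Prop :=
  Literature.NumberTheory.EllipticCurves.ModularForms.nonempty_modularParametrizationData

/-- item stmt-BirchSwinnertonDyer-19369 · aside · rank 9 · open · by planner
sources: GrossZagier1986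
[aside] Gross–Zagier 1986 Thm. I.(7.3) (p. 231; proof V.§2 pp. 310–313): L′(E,1) ≠ 0 ⇒ a rational
point of infinite order (via a Heegner point and the GZ formula) — a cite_only dep of this route
reached through the depth-1 support item PublishedInputsIMCReduction
(stmt-BirchSwinnertonDyer-19283, child of 19061; a third item layer is forbidden, so it is
item-stated here as a by-name ASIDE: banked context, never staffed, BC6-exempt; gate5 02:15:40Z
«aside also counts»); no crux statement / closes / tribunal change -/
@[route_item "route-BirchSwinnertonDyer-TameQuarticSolvent"]
def GrossZagierRationalPointI73 : Prop :=
  Literature.NumberTheory.EllipticCurves.GrossZagier1986_thm_I_7_3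

/-- item stmt-BirchSwinnertonDyer-19382 · aside · rank 9 · open · by planner
sources: BreuilConradDiamondTaylor2001
[support] Modularity Theorem, Version L (Diamond–Shurman 2005 Thm. 8.8.3; Wiles / Taylor–Wiles /
BCDT 2001 Thm. A): every E/ℚ has a weight-2 newform f of level N_E with L(f,s) = L(E,s) — conjunct
of PublishedInputsFive (stmt-BirchSwinnertonDyer-19066), BY NAME; same content, filed as a split
child so the head constant is item-stated (gate5 #15c one rule / readiness rule 2026-08-15: a
cite_only dep must be declared by the route); no crux statement / closes / tribunal / tribunal_fit
change -/
@[route_item "route-BirchSwinnertonDyer-TameQuarticSolvent"]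
def ModularityNewformSupply : Prop :=
  Literature.NumberTheory.EllipticCurves.ModularForms.exists_isNewformOf

/-- item stmt-BirchSwinnertonDyer-19921 · support · rank 9 · open · by operator
sources: GrossZagier1986, Kolyvagin1990
[support] The one PUBLISHED input the halves-glue consumes: Gross–Zagier–Kolyvagin, rank = analytic
rank for analytic rank ≤ 1 with Ш finite (tree named fact
rank_eq_analyticRank_of_analyticRank_le_one; used by bsdp_of_missingPPartAt to turn Miller's last
clause into BSD(E,2)). Carried as a displayed PUB hypothesis; never counted as progress. The further
PRINT of the roads to the two halves (Greenberg Thm-4.1 analogues at a multiplicative prime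
thm41Analogue_charValue_rankZero_numberField_anyPrime / …_split_baseChange_anyPrime, modularity) and
the referee-passed MEMO inputs (Kato ⊗ℚ at a multiplicative 2:
X5.O1.KatoMultiplicativeDivisibilityRat W 2, HOME mult/PROOF-MULT.md RC-2; Greenberg–Stevens at 2:
greenberg_stevens W 2, mult/PROOF-GS2.md RC-4) enter the LINES under the halves (bridge
multiplicativeRankZeroAtTwo_of_muRoad, p409679), not this glue. -/
@[route_item "route-BirchSwinnertonDyer-TameQuarticSolvent", crux]
def PublishedInputGZK : Prop :=
  Literature.NumberTheory.EllipticCurves.rank_eq_analyticRank_of_analyticRank_le_one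

/-- item stmt-BirchSwinnertonDyer-23974 · aside · rank 9 · open · by planner
sources: Milne1972ArithmeticAV, DokchitserDokchitser2010
[aside] Milne 1972 restriction of scalars: BSD_p-quotient of E over a relative quadratic extension =
product of the quotients of E and its twist, any model (Milne 1972 §1 Thm; Dokchitser–Dokchitser
2010 Thm 2.3 p-part form), BY NAME — conjunct of the split child SolventPublishedInputs
(stmt-BirchSwinnertonDyer-23962, PUB⁸ of crux 21391's line birth v6); same content, item-stated so
the head constant of this cite_only dep is declared by the route (gate5 #15c one rule «aside also
counts»; UTD 19266/19369 + FriedbergHoffstein aside precedent): banked context, never staffed,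
BC6-exempt, closes only by formalisation (`…_holds`); no crux statement / closes / tribunal change.
Filed by the pen (pss3x g0) to restore STAFFABLE after the 21391 split (deps.unproved rev 3 = these
7 constants). -/
@[route_item "route-BirchSwinnertonDyer-TameQuarticSolvent"]
def MilneRelQuadraticAnyModel : Prop :=
  Literature.NumberTheory.EllipticCurves.Milne1972.bsdQuotientP_baseChange_relQuadratic_anyModel

/-- item stmt-BirchSwinnertonDyer-23975 · aside · rank 9 · open · by planner
sources: FriedbergHoffstein1995
[aside] Friedberg–Hoffstein 1995 Thm B(1) over ℚ with the twisting discriminant d > 0, 3 ∥ d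
prescribed (rank-zero twist supply for stub_twistDatum), BY NAME — conjunct of the split child
SolventPublishedInputs (stmt-BirchSwinnertonDyer-23962, PUB⁸ of crux 21391's line birth v6); same
content, item-stated so the head constant of this cite_only dep is declared by the route (gate5 #15c
one rule «aside also counts»; UTD 19266/19369 + FriedbergHoffstein aside precedent): banked context,
never staffed, BC6-exempt, closes only by formalisation (`…_holds`); no crux statement / closes /
tribunal change. Filed by the pen (pss3x g0) to restore STAFFABLE after the 21391 split
(deps.unproved rev 3 = these 7 constants). -/
@[route_item "route-BirchSwinnertonDyer-TameQuarticSolvent"]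
def FriedbergHoffsteinRamifiedAtThree : Prop :=
  Literature.NumberTheory.EllipticCurves.friedbergHoffstein_exists_pos_twist_ne_zero_ramifiedAtThree

/-- item stmt-BirchSwinnertonDyer-23976 · aside · rank 9 · open · by planner
sources: FriedbergHoffstein1995, Nekovar2013
[aside] Friedberg–Hoffstein Thm B(1) over the real quadratic K = ℚ(√d) with local behaviour
prescribed above 3 and at one odd multiplicative prime («flip» class; w2 p583309), BY NAME —
conjunct of the split child SolventPublishedInputs (stmt-BirchSwinnertonDyer-23962, PUB⁸ of crux
21391's line birth v6); same content, item-stated so the head constant of this cite_only dep is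
declared by the route (gate5 #15c one rule «aside also counts»; UTD 19266/19369 + FriedbergHoffstein
aside precedent): banked context, never staffed, BC6-exempt, closes only by formalisation
(`…_holds`); no crux statement / closes / tribunal change. Filed by the pen (pss3x g0) to restore
STAFFABLE after the 21391 split (deps.unproved rev 3 = these 7 constants). -/
@[route_item "route-BirchSwinnertonDyer-TameQuarticSolvent"]
def FriedbergHoffsteinRealQuadraticTameAtThree : Prop :=
  Literature.NumberTheory.EllipticCurves.friedbergHoffstein_exists_twist_ne_zero_realQuadratic_tameAtThree

/-- item stmt-BirchSwinnertonDyer-23977 · aside · rank 9 · open · by planner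
sources: FriedbergHoffstein1995, Nekovar2013
[aside] Friedberg–Hoffstein Thm B(1) over the real quadratic K, «no-flip» class (w2 p583482), BY
NAME — conjunct of the split child SolventPublishedInputs (stmt-BirchSwinnertonDyer-23962, PUB⁸ of
crux 21391's line birth v6); same content, item-stated so the head constant of this cite_only dep is
declared by the route (gate5 #15c one rule «aside also counts»; UTD 19266/19369 + FriedbergHoffstein
aside precedent): banked context, never staffed, BC6-exempt, closes only by formalisation
(`…_holds`); no crux statement / closes / tribunal change. Filed by the pen (pss3x g0) to restore
STAFFABLE after the 21391 split (deps.unproved rev 3 = these 7 constants). -/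
@[route_item "route-BirchSwinnertonDyer-TameQuarticSolvent"]
def FriedbergHoffsteinRealQuadraticTameAtThreeNoflip : Prop :=
  Literature.NumberTheory.EllipticCurves.friedbergHoffstein_exists_twist_ne_zero_realQuadratic_tameAtThree_noflip

/-- item stmt-BirchSwinnertonDyer-21394 · assembly · rank 1 · closed · proved by Summit.BirchSwinnertonDyer.BirchSwinnertonDyer.Theorems.TameQuarticSolvent.assembly_proof (prover) · by planner
sources: Milne1972ArithmeticAV, GrossZagier1986, Kolyvagin1990
[assembly] PublishedInputGZK → SolventPairLowerBound → TprimeRankZeroUpperAtThree →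
TprimeRankOneUpperAtThree → WAllExclAddTprimeAtThreeRankOne (the registered W-ALL slice leaf, (t′)
at 3 rank one; proved as `closes` in glue.lean). -/
@[route_item "route-BirchSwinnertonDyer-TameQuarticSolvent"]
def Assembly : Prop :=
  PublishedInputGZK → SolventPairLowerBound → TprimeRankZeroUpperAtThree → TprimeRankOneUpperAtThree → Summit.BirchSwinnertonDyer.WAllExclAddTprimeAtThreeRankOne

-- `Assembly` holds: proved by `Summit.BirchSwinnertonDyer.BirchSwinnertonDyer.Theorems.TameQuarticSolvent.assembly_proof` (its module imports this route file, so no `_holds` link can be stated here).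

/-! D-0027 §2.1 — DECIDING THEOREM (planner-authored via `route open/edit --closes-file`; by planner-bsd-wall-pss3-g6-0 2026-08-27T18:48:34Z):
its hypotheses are this route's items and its conclusion the registered leaf `Summit.BirchSwinnertonDyer.WAllExclAddTprimeAtThreeRankOne` (rung W-ALL/2@3.TprimeAtThreeRankOne, D-0061) (glue_lint), and it elaborates with this file. -/

@[closes "route-BirchSwinnertonDyer-TameQuarticSolvent"] theorem closes (hP : PublishedInputGZK) (hA : SolventPairLowerBound) (hC : TprimeRankZeroUpperAtThree)
    (hB : TprimeRankOneUpperAtThree) : Summit.BirchSwinnertonDyer.WAllExclAddTprimeAtThreeRankOne := by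
  intro W _ _ hCM hadd hsub hr
  obtain ⟨d, Wd, _, _, -, -, -, hCMd, haddd, hsubd, hr0, q, q', hq, hq', hle⟩ := hA W hCM hadd hsub hr
  obtain ⟨q'', hq'', hge⟩ := hC Wd hCMd haddd hsubd hr0
  have hqq : q'' = q' := by exact_mod_cast hq''.symm.trans hq'
  subst hqq
  have hlow : Literature.NumberTheory.EllipticCurves.Rank1Residual.Typed.MissingLowerBoundAt W 3 := ⟨q, hq, by linarith⟩
  exact Literature.NumberTheory.EllipticCurves.Rank1Residual.Typed.bsdp_of_missingPPartAt W 3 hP (by omega)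
    (Literature.NumberTheory.EllipticCurves.Rank1Residual.Typed.missingPPartAt_of_lower_of_upper W 3 hlow (hB W hCM hadd hsub hr))

end Summit.BirchSwinnertonDyer.BirchSwinnertonDyer.Theses.TameQuarticSolvent
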